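import Literature.AnabelianGeometry.EtaleTheta.ArithThetaTowerConstFunctor
import Literature.AnabelianGeometry.EtaleTheta.ArithThetaTowerCdashFaithful
import Literature.AnabelianGeometry.EtaleTheta.ArithThetaTowerIsFrobenioid
import HarnessLib

/-!
# [IUTchI] Ex. 3.2 (ii)/(v) at the ARITHMETIC theta tower: the `𝒞^Θ_v → ℱ÷_v` slot FROM THE GENUINE CONSTANTS and the
# REAL-birationalization rest input it yields — C0 NON-VACUITY MILESTONE of the slot type over the decoupling spec
# (GAP A item GA-15 = C0, file 2/2; COUNT-NEUTRAL)

S. Mochizuki, *Inter-universal Teichmüller Theory I* [Mochizuki2012], Ex. 3.2 (ii) p. 70 («`ℱ÷_v := ℱ̲_v^birat`», «`Θ̲_v ∈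
𝒪^×(T^÷_{Ÿ_v})`», «`l·ℤ ⊆ Aut(T_{Ÿ_v})`»), (v) p. 72 («`𝒟^Θ_v ⊆ (𝒟_v)_{Ÿ_v}` … `𝒞^Θ_v (⊆ ℱ÷_v)` — which may be thought of as a
subcategory of `ℱ÷_v`», «we have a natural equivalence of categories `𝒞⊢_v ⥲ 𝒞^Θ_v`») [claim: Mochizuki2012, status: disputed]
(D-0012 claim key; CONSTRUCTIONS over our typed objects, nothing of the series asserted); *The geometry of Frobenioids I*
[MochizukiFrdI2008] Prop. 4.4 (i)(ii) p. 83 (`C → C^birat` over the base, faithful; the tree's `PreFrobenioid.toBirat`,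
`toBirat_faithful`, `biratOverBase`), Cor. 5.4 p. 104.

GAP A of record G-L5-EX32I-1 (abc-iut cell), item GA-15; RULINGS #344 (B) (chair, 2026-08-28): the slot structure
`TemperedThetaRestBirat d T hq C hF` (BadLocalFrobenioidOfKitsTemperedBiratReal.lean) constrains its field `CThetaToBirat` by
«functor + faithful + base» ONLY — the slot TYPE does not relate `CThetaToBirat` to `theta` (:101–124; ERRATA-L5 I-127) —, so
the CONSTANTS composite below inhabits it
legitimately WITHOUT being print's Ex. 3.2 (v) arrow (generator ↦ the class of `Θ̲_v`); accordingly THIS FILE IS THE C0 NV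
MILESTONE ONLY — «`CThetaToBirat` slot inhabited by the CONSTANTS composite (disclosed); Θ̲-compatible functor = GA-06's
`cThetaToBirat` (ArithThetaTowerCThetaToBirat.lean) → GA-16; COUNT-NEUTRAL» — and NOT «`𝒞^Θ_v ⊆ ℱ÷_v` realised»; the C0 WITNESS
OF RECORD (`thetaRestBirat_ofDoubleUnderline'`, with `CThetaToBirat := cThetaToBirat hC hF hq` BY NAME) is the sibling file
`ArithThetaTowerOneDatumWitness.lean`, and the A-token inhabitant (GA-07) must carry the Θ̲-reading (#344 (B)(iii)).

WHAT IS HERE, over the §0/§5 BINDERS `(C : TemperedFrobenioid T' T.Dv VD) (hC : CarrierSpec d T C) (hF) {qroot} (hq) (l : ℕ)`: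
* `prodSndNatTrans T : (Ÿ_v × −) ⟶ (𝒟⊢_v ⊆ 𝒟_v)` (the second projections; natural by `prodMap_snd`);
* **`cThetaToBiratOfConsts hC hF hq : T.CTheta d hq ⥤ PreFrobenioid.Birat C.toElem hF _`** := `𝒞^Θ_v ≃ 𝒞⊢_v` (the tree's
  `dashThetaEquiv`, BadLocalFrobenioidDash.lean) ⋙ the genuine-constants functor over `(Ÿ_v × −)` (file 1/2
  `constFunctorOver`, constants via `T.proj` — crit-A F2) ⋙ `PreFrobenioid.toBirat` BY NAME; DISCLOSED READING: the generator
  of `Φ_{𝒞^Θ_v} ≅ ℕ` goes to `log_Φ(q̲_v)|_{Ÿ_v × A}` — the tree's own MODELLING CHOICE for `T.CTheta` («the divisor class of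
  `q̲_v` READ AS the formal symbol `log(Θ̲_v)`») — i.e. the composite «𝒞^Θ_v ≃ 𝒞⊢_v → 𝒞_v|_{Ÿ_v × (−)} ⊆ ℱ̲_v → ℱ÷_v»;
* `cThetaToBiratOfConsts_faithful` (equivalence ⋙ faithful ⋙ faithful) and **`cThetaToBiratOfConstsBaseIso`**: it lies over
  `𝒟^Θ_v ⊆ (𝒟_v)_{Ÿ_v} → 𝒟_v` (`biratOverBase`, `constFunctorOver_comp_base`, `prodEquivCompInclIso`,
  `dashThetaEquiv_comp_base`, the counit of `dashThetaEquiv`);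
* **`thetaRestBiratOfConsts hC hF hq l CdashToC h₁ h₂ : TemperedThetaRestBirat d T hq C hF`** — GA-06's data fields
  `theta hC hF` / `lZ hC l` / `constUnits hC hF` BY NAME + this slot + a GIVEN `𝒞⊢_v → 𝒞_v` triple (GA-13's
  `cdashToC hC hq`, `cdashToC_faithful`, `cdashToC_base`, ArithThetaTowerCdashFaithful.lean), assembled by GA-06's
  `ThetaRestBiratData.toRestBirat`; `nonempty_thetaRestBirat_of_carrierSpec`; binder-free with GA-13's triple BY NAME:
  **`thetaRestBiratOfConsts' hC hF hq l`**, `thetaRestBiratOfConsts'_fields`, **`nonempty_thetaRestBirat_of_carrierSpec' hC hF hq l`**.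

carrier: genuine-by-[EtTh]-recipe on the T-lattice (Ÿ_T, Ÿ_T × V, X̲̲_v̲ × V) + constants everywhere; off-lattice Φ via
`rebase`/pullback; [EtTh] Def 3.3 Φ at general U and print's Ÿ̈/μ_N Kummer levels = FOUNDATIONS 13/14, not claimed (#322
(c3′); this file defines no carrier).  HONEST FRAMING: a COUNT-NEUTRAL non-vacuity construction over a `Prop`-valued spec at
OUR typed objects; TYPED ≠ INHABITED-IN-PRINT ≠ proved-in-print; the Θ̲-compatibility of print's `𝒞^Θ_v ⊆ ℱ÷_v` is GA-06's
`cThetaToBirat` (functor) + GA-16 (faithful, base), NOT this file; an UNDISPUTED construction around [IUTchIII] Cor. 3.12,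
which stays OPEN by charter (D-0045) — no side taken on it or on any author; nothing here asserts the abc conjecture proved
or refuted.  No instance, no notation, no `sorry`.
-/

noncomputable section

namespace Literature.AnabelianGeometry.EtaleTheta

namespace ArithThetaTower

open CategoryTheory Opposite Function Literature.AlgebraicGeometry.Frobenioids Literature.AnabelianGeometry.SemiGraphs
  Literature.IUT.HodgeTheaters Literature.AlgebraicGeometry.Frobenioids.PadicFrd

variable {p : ℕ} [Fact p.Prime] {d : GaloisValDatum.{0} p} {P : Type} [Group P] [TopologicalSpace P]
  {T : BadLocalGroupDatum d.Gal P}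
  {T' : RealifiedDivisorMonoids (D₀ := T.Dv) treeMonoidVocabWeak.{0}} {VD : FrdICatStub.{0, 0, 0} T.Dv}
  {C : TemperedFrobenioid T' T.Dv VD}

variable (T) in
/-- The second projections `Ÿ_v × A → A` as a natural transformation `(Ÿ_v × −) ⟶ (𝒟⊢_v ⊆ 𝒟_v)` (natural by
`prodMap_snd`). [cite: Mochizuki2012, I Ex 3.2 (v) p.72] -/
def prodSndNatTrans : T.prodFunctor ⋙ Over.forget T.ydd ⟶ T.incl where
  app V := T.prodSnd V
  naturality _ _ f := T.prodMap_snd f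

/-- `(Ÿ_v × −) : 𝒟⊢_v ⥤ 𝒟_v` is faithful. [cite: Mochizuki2012, I Ex 3.2 (v) p.72] -/
theorem prodFunctor_forget_faithful (T : BadLocalGroupDatum d.Gal P) : (T.prodFunctor ⋙ Over.forget T.ydd).Faithful :=
  haveI := T.prodFunctor_faithful
  Functor.Faithful.comp _ _

/-- **`𝒞^Θ_v → ℱ÷_v = ℱ̲_v^birat` FROM THE GENUINE CONSTANTS**: `𝒞^Θ_v ≃ 𝒞⊢_v` (the tree's `dashThetaEquiv`) followed
by the constants functor over `(Ÿ_v × −)` (genuine constants at the objects `Ÿ_v × A` via `T.proj`) and by [FrdI] Prop. 4.4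
`ℱ̲_v → ℱ̲_v^birat` (`PreFrobenioid.toBirat` BY NAME).  DISCLOSED READING: the generator of `Φ_{𝒞^Θ_v} ≅ ℕ` is read as
`log_Φ(q̲_v)|_{Ÿ_v × A}` — the tree's MODELLING CHOICE for `T.CTheta` (BadLocalFrobenioidDash.lean) —; print's extra
compatibility «`q̲_v|_{T_A} ↦ Θ̲_v|_{T_{A^Θ}}`» (Ex. 3.2 (v)) is GA-06's `cThetaToBirat`, not this functor.
([IUTchI] Ex 3.2 (v) p.72) [claim: Mochizuki2012, status: disputed] -/
def cThetaToBiratOfConsts (hC : CarrierSpec d T C) (hF : PreFrobenioid.IsFrobenioid C.toElem)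
    {qroot : intNonzero d.k} (hq : ¬ IsUnit qroot) :
    T.CTheta d hq ⥤ PreFrobenioid.Birat C.toElem hF (PreFrobenioid.hasBiratSquares_of_isFrobenioid hF) :=
  (T.dashThetaEquiv d hq).inverse ⋙ constFunctorOver (T.prodFunctor ⋙ Over.forget T.ydd) (prodSndNatTrans T) hC hq ⋙
    PreFrobenioid.toBirat C.toElem hF _

/-- **`𝒞^Θ_v → ℱ÷_v` is faithful** (an equivalence, then the faithful constants functor over the faithful `(Ÿ_v × −)`, then
the faithful `toBirat` of [FrdI] Prop. 4.4 (ii)). ([IUTchI] Ex 3.2 (v) p.72) [claim: Mochizuki2012, status: disputed] -/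
theorem cThetaToBiratOfConsts_faithful (hC : CarrierSpec d T C) (hF : PreFrobenioid.IsFrobenioid C.toElem)
    {qroot : intNonzero d.k} (hq : ¬ IsUnit qroot) : (cThetaToBiratOfConsts hC hF hq).Faithful := by
  haveI := prodFunctor_forget_faithful T
  haveI := constFunctorOver_faithful (T.prodFunctor ⋙ Over.forget T.ydd) (prodSndNatTrans T) hC hq
  haveI := PreFrobenioid.toBirat_faithful (F := C.toElem) hF (PreFrobenioid.hasBiratSquares_of_isFrobenioid hF)
  unfold cThetaToBiratOfConsts
  infer_instance

/-- **`𝒞^Θ_v → ℱ÷_v` lies over `𝒟^Θ_v ⊆ (𝒟_v)_{Ÿ_v} → 𝒟_v`**: `toBirat` lies over `𝒟_v` (`biratOverBase`), the constants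
functor lies over `(Ÿ_v × −)` on the nose, `𝒞⊢_v ≃ 𝒞^Θ_v` lies over `𝒟⊢_v ≃ 𝒟^Θ_v` on the nose (`dashThetaEquiv_comp_base`),
and `𝒟⊢_v ≃ 𝒟^Θ_v ⊆ (𝒟_v)_{Ÿ_v}` is `(Ÿ_v × −)` (`prodEquivCompInclIso`). ([IUTchI] Ex 3.2 (v) p.72)
[claim: Mochizuki2012, status: disputed] -/
def cThetaToBiratOfConstsBaseIso (hC : CarrierSpec d T C) (hF : PreFrobenioid.IsFrobenioid C.toElem)
    {qroot : intNonzero d.k} (hq : ¬ IsUnit qroot) :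
    cThetaToBiratOfConsts hC hF hq ⋙
        (PreFrobenioid.biratOps hF (PreFrobenioid.hasBiratSquares_of_isFrobenioid hF)).base ≅
      T.CThetaBase d hq ⋙ T.dThetaIncl ⋙ Over.forget T.ydd :=
  let E := T.dashThetaEquiv d hq
  let Gp := T.prodFunctor ⋙ Over.forget T.ydd
  let F := constFunctorOver Gp (prodSndNatTrans T) hC hq
  let hsq := PreFrobenioid.hasBiratSquares_of_isFrobenioid hF
  let toB := PreFrobenioid.toBirat C.toElem hF hsq
  let B := (PreFrobenioid.biratOps hF hsq).base
  have h₃ : E.inverse ⋙ (d.CdashBase hq ⋙ T.prodEquiv.functor) = E.inverse ⋙ (E.functor ⋙ T.CThetaBase d hq) :=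
    congrArg (E.inverse ⋙ ·) (T.dashThetaEquiv_comp_base d hq).symm
  (show (E.inverse ⋙ F ⋙ toB) ⋙ B ≅ E.inverse ⋙ (F ⋙ toB) ⋙ B from Functor.associator _ _ _) ≪≫
    Functor.isoWhiskerLeft E.inverse (Functor.associator F toB B) ≪≫
    Functor.isoWhiskerLeft E.inverse (Functor.isoWhiskerLeft F (PreFrobenioid.biratOverBase hF hsq)) ≪≫
    Functor.isoWhiskerLeft E.inverse (eqToIso (constFunctorOver_comp_base Gp (prodSndNatTrans T) hC hq)) ≪≫
    Functor.isoWhiskerLeft E.inverse (Functor.isoWhiskerLeft (d.CdashBase hq)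
      (Functor.isoWhiskerRight T.prodEquivCompInclIso.symm (Over.forget T.ydd))) ≪≫
    (show E.inverse ⋙ d.CdashBase hq ⋙ (T.prodEquiv.functor ⋙ T.dThetaIncl) ⋙ Over.forget T.ydd ≅
        (E.inverse ⋙ d.CdashBase hq ⋙ T.prodEquiv.functor) ⋙ T.dThetaIncl ⋙ Over.forget T.ydd from eqToIso rfl) ≪≫
    Functor.isoWhiskerRight (eqToIso h₃ ≪≫ (Functor.associator E.inverse E.functor (T.CThetaBase d hq)).symm ≪≫
      Functor.isoWhiskerRight E.counitIso (T.CThetaBase d hq) ≪≫ (T.CThetaBase d hq).leftUnitor) (T.dThetaIncl ⋙ Over.forget T.ydd)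

/-- **The REAL-birationalization rest input FROM THE GENUINE CONSTANTS** over the decoupling spec: GA-06's data fields
`Θ̲_v := theta hC hF`, `l·ℤ := lZ hC l`, constants `constUnits hC hF` BY NAME, the `𝒞^Θ_v` slot `cThetaToBiratOfConsts`
(faithful, over the right base), and a GIVEN `𝒞⊢_v → 𝒞_v` triple `(CdashToC, h₁, h₂)` (GA-13's, or `cdashToHullOfConsts`).
([IUTchI] Ex 3.2 (ii) p.70) [claim: Mochizuki2012, status: disputed] -/
def thetaRestBiratOfConsts (hC : CarrierSpec d T C) (hF : PreFrobenioid.IsFrobenioid C.toElem)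
    {qroot : intNonzero d.k} (hq : ¬ IsUnit qroot) (l : ℕ) (CdashToC : d.Cdash hq ⥤ C.hullCategory)
    (h₁ : CdashToC.Faithful)
    (h₂ : Nonempty (CdashToC ⋙ C.hull ⋙ C.baseFunctorOfCategory ≅ d.CdashBase hq ⋙ T.incl)) :
    TemperedThetaRestBirat d T hq C hF :=
  (⟨theta hC hF, lZ hC l, constUnits hC hF, cThetaToBiratOfConsts hC hF hq⟩ : ThetaRestBiratData d T C hF hq).toRestBirat
    CdashToC h₁ h₂ (cThetaToBiratOfConsts_faithful hC hF hq) ⟨cThetaToBiratOfConstsBaseIso hC hF hq⟩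

/-- **Non-vacuity of the slot TYPE over the binders**: given the `𝒞⊢_v → 𝒞_v` triple, `TemperedThetaRestBirat d T hq C hF` is
inhabited for EVERY carrier satisfying the spec. ([IUTchI] Ex 3.2 (ii) p.70) [claim: Mochizuki2012, status: disputed] -/
theorem nonempty_thetaRestBirat_of_carrierSpec (hC : CarrierSpec d T C) (hF : PreFrobenioid.IsFrobenioid C.toElem)
    {qroot : intNonzero d.k} (hq : ¬ IsUnit qroot) (l : ℕ) (CdashToC : d.Cdash hq ⥤ C.hullCategory)
    (h₁ : CdashToC.Faithful)
    (h₂ : Nonempty (CdashToC ⋙ C.hull ⋙ C.baseFunctorOfCategory ≅ d.CdashBase hq ⋙ T.incl)) :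
    Nonempty (TemperedThetaRestBirat d T hq C hF) :=
  ⟨thetaRestBiratOfConsts hC hF hq l CdashToC h₁ h₂⟩


/-- **The C0 NV MILESTONE inhabitant, binder-free over the spec**: `thetaRestBiratOfConsts` fed with GA-13's GENUINE
`𝒞⊢_v → 𝒞_v` triple `cdashToC hC hq` / `cdashToC_faithful` / `cdashToC_base` (ArithThetaTowerCdashFaithful.lean) BY NAME.
`CThetaToBirat` slot = the CONSTANTS composite (disclosed; RULINGS #344 (B)(i)) — the Θ̲-reading inhabitant of record is
GA-16's `thetaRestBirat_of_carrierSpec`. ([IUTchI] Ex 3.2 (ii) p.70) [claim: Mochizuki2012, status: disputed] -/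
def thetaRestBiratOfConsts' (hC : CarrierSpec d T C) (hF : PreFrobenioid.IsFrobenioid C.toElem)
    {qroot : intNonzero d.k} (hq : ¬ IsUnit qroot) (l : ℕ) : TemperedThetaRestBirat d T hq C hF :=
  thetaRestBiratOfConsts hC hF hq l (cdashToC hC hq) (cdashToC_faithful hC hq) (cdashToC_base hC hq)

/-- Its `CdashToC` field IS GA-13's `cdashToC hC hq` and its `CThetaToBirat` field IS `cThetaToBiratOfConsts hC hF hq`.
([IUTchI] Ex 3.2 (iv)(v) pp.71-72) [claim: Mochizuki2012, status: disputed] -/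
theorem thetaRestBiratOfConsts'_fields (hC : CarrierSpec d T C) (hF : PreFrobenioid.IsFrobenioid C.toElem)
    {qroot : intNonzero d.k} (hq : ¬ IsUnit qroot) (l : ℕ) :
    (thetaRestBiratOfConsts' hC hF hq l).CdashToC = cdashToC hC hq ∧
      (thetaRestBiratOfConsts' hC hF hq l).CThetaToBirat = cThetaToBiratOfConsts hC hF hq ∧
      (thetaRestBiratOfConsts' hC hF hq l).theta = theta hC hF ∧ (thetaRestBiratOfConsts' hC hF hq l).lZ = lZ hC l ∧
      (thetaRestBiratOfConsts' hC hF hq l).constUnits = constUnits hC hF :=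
  ⟨rfl, rfl, rfl, rfl, rfl⟩

/-- **C0 NV MILESTONE over the binders (COUNT-NEUTRAL)**: for EVERY carrier satisfying the decoupling spec which is a Frobenioid,
every non-unit `q̲`-root and every `l`, the slot type `TemperedThetaRestBirat d T hq C hF` is INHABITED — all nine fields, both
functor laws NON-VACUOUS (faithful over all of `𝒟⊢_v` / `𝒟^Θ_v`, genuine constants).  Wording of record (#344 (B)(i)): «C0 NV
MILESTONE — `CThetaToBirat` slot inhabited by the CONSTANTS composite (disclosed); Θ̲-compatible functor = GA-06 → GA-16;
COUNT-NEUTRAL», NOT «`𝒞^Θ_v ⊆ ℱ÷_v` realised». ([IUTchI] Ex 3.2 (ii) p.70) [claim: Mochizuki2012, status: disputed] -/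
theorem nonempty_thetaRestBirat_of_carrierSpec' (hC : CarrierSpec d T C) (hF : PreFrobenioid.IsFrobenioid C.toElem)
    {qroot : intNonzero d.k} (hq : ¬ IsUnit qroot) (l : ℕ) : Nonempty (TemperedThetaRestBirat d T hq C hF) :=
  ⟨thetaRestBiratOfConsts' hC hF hq l⟩

end ArithThetaTower

end Literature.AnabelianGeometry.EtaleTheta

end
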